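import Mathlib

/-!
# `ExactCertificate` (stmt-AtomisticToContinuum-11959), line `closure-makes-nogap-exact`,
# Transfer skeleton II (`Cruxes.ExactCertificate.Transfer1D.Crystallization1D`): stub `stub_lineEnergyConvex`

Support file for the crux `ThreeConeCertificate.ExactCertificate` (crux 11959), line
`closure-makes-nogap-exact`, TRANSFER skeleton II `Crystallization1D` (positional crystallization of
the Lennard-Jones chain, `d = 1`).  This file proves the registered stub `stub_lineEnergyConvex`:
UNIFORM MIDPOINT CONVEXITY OF THE LINE ENERGY IN GAP COORDINATES on the box `[3/4, 1]`.

For an abstract pair potential `V : ℝ → ℝ` which is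
* uniformly midpoint-convex on `[3/4, 1]`:
  `V((s+t)/2) ≤ (V s + V t)/2 − (3/4)(s − t)²` for `s, t ∈ [3/4, 1]`, and
* not too concave far out: `V((s+t)/2) ≤ (V s + V t)/2 + (7/8) R⁻⁸ (s − t)²` for `0 < R ≤ s, t`,

and two increasing configurations `y, z : ℕ → ℝ` whose nearest-neighbour gaps lie in `[3/4, 1]`,
the line energy `Σ_{i<j<N} V(x_j − x_i)` of the midpoint configuration `x = (y + z)/2` is below the
average of the energies of `y` and `z` by `¼ Σ_{i<N-1} u_i²`, `u_i := (z(i+1) − z i) − (y(i+1) − y i)`.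

Mechanism (pure finite-sum algebra).  Reindex the pair sum by `(k, i)`, `j = i + k`
(`lineConvex_sum_pair_reindex`).  For a pair at index distance `k` the two gaps
`s = y(i+k) − y i`, `t = z(i+k) − z i` lie in `[3k/4, k]` (telescoping, `lineConvex_gap_bounds`) and
`t − s = Σ_{l<k} u_{i+l}` (`lineConvex_tele`).  Nearest neighbours (`k = 1`) gain `−(3/4) u_i²`;
`k`-th neighbours (`k ≥ 2`, `R = 3k/4`) cost at most `(7/8)(3k/4)⁻⁸ (Σ_{l<k} u_{i+l})²
≤ (7/8)(3k/4)⁻⁸ · k · Σ_{l<k} u_{i+l}²` (Cauchy–Schwarz, `sq_sum_le_card_mul_sum_sq`), and summing the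
shifted windows over `i` gives at most `k · Σ_i u_i²` (`lineConvex_shift_sum_le`), so slice `k` costs
`≤ (7/8)(4/3)⁸ k⁻⁶ Σ u² = (57344/6561) k⁻⁶ Σ u²`.  Finally `Σ_{k≥2} k⁻⁶ ≤ 1/32`
(`k⁻⁶ ≤ (1/32)(1/(k−1) − 1/k)`, telescoping; `lineConvex_sum_inv_pow_six_le`) and
`(57344/6561)/32 = 1792/6561 < 1/2`, whence `−3/4 + 1/2 = −1/4`.  All `[folklore]`.
-/

noncomputable section

namespace Summit.AtomisticToContinuum.Crystallization.Theorems.ThreeConeCertificateExactCertificate.Transfer1D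

open scoped BigOperators

/-- Reindexing the sum over pairs `i < j < N` by the index distance `k = j − i` and the left
endpoint `i`. [folklore] -/
theorem lineConvex_sum_pair_reindex (N : ℕ) (F : ℕ → ℕ → ℝ) :
    ∑ i ∈ Finset.range N, ∑ j ∈ Finset.Ico (i + 1) N, F i j =
      ∑ k ∈ Finset.Ico 1 N, ∑ i ∈ Finset.range (N - k), F i (i + k) := by
  have h1 : ∀ i ∈ Finset.range N, ∑ j ∈ Finset.Ico (i + 1) N, F i j =
      ∑ k ∈ Finset.Ico 1 (N - i), F i (i + k) := by
    intro i _
    rw [Finset.sum_Ico_eq_sum_range, Finset.sum_Ico_eq_sum_range]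
    refine Finset.sum_congr (by rw [show N - (i + 1) = N - i - 1 by omega]) fun m _ => ?_
    rw [show i + 1 + m = i + (1 + m) by omega]
  rw [Finset.sum_congr rfl h1]
  refine Finset.sum_comm' fun i k => ?_
  simp only [Finset.mem_range, Finset.mem_Ico]
  omega

/-- Telescoping of the gaps: a configuration whose nearest-neighbour gaps lie in `[3/4, 1]` has its
`k`-th neighbour gaps in `[3k/4, k]`. [folklore] -/
theorem lineConvex_gap_bounds {N : ℕ} {y : ℕ → ℝ}
    (hy : ∀ i : ℕ, i + 1 < N → 3 / 4 ≤ y (i + 1) - y i ∧ y (i + 1) - y i ≤ 1) :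
    ∀ k i : ℕ, i + k < N → 3 / 4 * (k : ℝ) ≤ y (i + k) - y i ∧ y (i + k) - y i ≤ k := by
  intro k
  induction k with
  | zero => intro i _; simp
  | succ k ih =>
    intro i hik
    obtain ⟨h1, h2⟩ := ih i (by omega)
    obtain ⟨h3, h4⟩ := hy (i + k) (by omega)
    simp only [← add_assoc]
    push_cast
    constructor <;> linarith

/-- Telescoping of the gap differences: `Σ_{l<k} u_{i+l} = (z(i+k) − z i) − (y(i+k) − y i)` for
`u_l = (z(l+1) − z l) − (y(l+1) − y l)`. [folklore] -/
theorem lineConvex_tele (y z : ℕ → ℝ) (i k : ℕ) :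
    ∑ l ∈ Finset.range k, ((z (i + l + 1) - z (i + l)) - (y (i + l + 1) - y (i + l))) =
      (z (i + k) - z i) - (y (i + k) - y i) := by
  induction k with
  | zero => simp
  | succ k ih =>
    rw [Finset.sum_range_succ, ih]
    simp only [← add_assoc]
    ring

/-- A shifted window of a sum of nonnegative terms is a sub-sum:
`Σ_{i<n} g(i+l) ≤ Σ_{m<M} g m` whenever `n + l ≤ M`. [folklore] -/
theorem lineConvex_shift_sum_le (g : ℕ → ℝ) (hg : ∀ m, 0 ≤ g m) (n l M : ℕ) (h : n + l ≤ M) :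
    ∑ i ∈ Finset.range n, g (i + l) ≤ ∑ m ∈ Finset.range M, g m := by
  calc ∑ i ∈ Finset.range n, g (i + l)
      ≤ ∑ m ∈ Finset.range l, g m + ∑ i ∈ Finset.range n, g (l + i) := by
        have h0 : 0 ≤ ∑ m ∈ Finset.range l, g m := Finset.sum_nonneg fun m _ => hg m
        have h1 : ∑ i ∈ Finset.range n, g (i + l) = ∑ i ∈ Finset.range n, g (l + i) :=
          Finset.sum_congr rfl fun i _ => by rw [add_comm]
        linarith
    _ = ∑ m ∈ Finset.range (l + n), g m := (Finset.sum_range_add g l n).symm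
    _ ≤ ∑ m ∈ Finset.range M, g m :=
        Finset.sum_le_sum_of_subset_of_nonneg (Finset.range_subset_range.2 (by omega))
          fun m _ _ => hg m

/-- The elementary bound `k⁻⁶ ≤ (1/32)·(1/(k−1) − 1/k)` for `k ≥ 2` (equality at `k = 2`).
[folklore] -/
theorem lineConvex_inv_pow_six_le (k : ℕ) (hk : 2 ≤ k) :
    1 / (k : ℝ) ^ 6 ≤ 1 / 32 * (1 / ((k : ℝ) - 1) - 1 / k) := by
  obtain ⟨m, rfl⟩ : ∃ m, k = m + 2 := ⟨k - 2, by omega⟩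
  push_cast
  have hm : (0 : ℝ) ≤ m := m.cast_nonneg
  rw [show (m : ℝ) + 2 - 1 = m + 1 by ring,
    show (1 : ℝ) / 32 * (1 / ((m : ℝ) + 1) - 1 / ((m : ℝ) + 2)) = 1 / (32 * ((m + 1) * (m + 2))) by
      field_simp; ring]
  apply one_div_le_one_div_of_le (by positivity)
  nlinarith [pow_nonneg hm 3, pow_nonneg hm 4, pow_nonneg hm 5, pow_nonneg hm 6, sq_nonneg (m : ℝ)]

/-- Telescoped: `Σ_{2 ≤ k < N} k⁻⁶ ≤ 1/32`. [folklore] -/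
theorem lineConvex_sum_inv_pow_six_le (N : ℕ) :
    ∑ k ∈ Finset.Ico 2 N, 1 / (k : ℝ) ^ 6 ≤ 1 / 32 := by
  rcases lt_or_ge N 2 with hN | hN
  · rw [Finset.Ico_eq_empty_of_le (by omega), Finset.sum_empty]; norm_num
  · suffices h : ∑ k ∈ Finset.Ico 2 N, 1 / (k : ℝ) ^ 6 ≤ 1 / 32 - 1 / 32 * (1 / ((N : ℝ) - 1)) by
      have h1 : (2 : ℝ) ≤ N := by exact_mod_cast hN
      have h2 : (0 : ℝ) ≤ 1 / ((N : ℝ) - 1) := by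
        apply div_nonneg zero_le_one; linarith
      linarith
    induction N, hN using Nat.le_induction with
    | base => norm_num
    | succ n hn ih =>
      rw [Finset.sum_Ico_succ_top hn]
      have := lineConvex_inv_pow_six_le n hn
      push_cast
      rw [show (n : ℝ) + 1 - 1 = n by ring]
      linarith

/-- The pairwise midpoint inequality for a pair at index distance `k ≥ 1`, in terms of the gap
differences `u_l = (z(l+1) − z l) − (y(l+1) − y l)` and the slice weights `c` (`c 1 = −3/4` from the
uniform midpoint convexity on `[3/4, 1]`; `c k = (7/8)(3k/4)⁻⁸·k` for `k ≥ 2` from the concavity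
allowance at `R = 3k/4` and Cauchy–Schwarz). [folklore] -/
theorem lineConvex_pointwise (V : ℝ → ℝ)
    (hV1 : ∀ s t : ℝ, 3 / 4 ≤ s → s ≤ 1 → 3 / 4 ≤ t → t ≤ 1 →
      V ((s + t) / 2) ≤ (V s + V t) / 2 - 3 / 4 * (s - t) ^ 2)
    (hV2 : ∀ R s t : ℝ, 0 < R → R ≤ s → R ≤ t →
      V ((s + t) / 2) ≤ (V s + V t) / 2 + 7 / 8 * (R⁻¹) ^ 8 * (s - t) ^ 2)
    {N : ℕ} {y z : ℕ → ℝ}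
    (hy : ∀ i : ℕ, i + 1 < N → 3 / 4 ≤ y (i + 1) - y i ∧ y (i + 1) - y i ≤ 1)
    (hz : ∀ i : ℕ, i + 1 < N → 3 / 4 ≤ z (i + 1) - z i ∧ z (i + 1) - z i ≤ 1)
    (c : ℕ → ℝ) (hc1 : c 1 = -(3 / 4))
    (hc2 : ∀ k : ℕ, 2 ≤ k → c k = 7 / 8 * ((3 * (k : ℝ) / 4)⁻¹) ^ 8 * k)
    {k i : ℕ} (hk : 1 ≤ k) (hik : i + k < N) :
    V ((y (i + k) + z (i + k)) / 2 - (y i + z i) / 2) ≤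
      (V (y (i + k) - y i) + V (z (i + k) - z i)) / 2 +
        c k * ∑ l ∈ Finset.range k, ((z (i + l + 1) - z (i + l)) - (y (i + l + 1) - y (i + l))) ^ 2 := by
  obtain ⟨hs1, hs2⟩ := lineConvex_gap_bounds hy k i hik
  obtain ⟨ht1, ht2⟩ := lineConvex_gap_bounds hz k i hik
  have htele := lineConvex_tele y z i k
  rw [show (y (i + k) + z (i + k)) / 2 - (y i + z i) / 2 =
    ((y (i + k) - y i) + (z (i + k) - z i)) / 2 by ring]
  set s := y (i + k) - y i
  set t := z (i + k) - z i
  rcases eq_or_lt_of_le hk with h1 | h2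
  · subst h1
    simp only [Finset.sum_range_one, add_zero, Nat.cast_one, mul_one] at htele hs1 hs2 ht1 ht2 ⊢
    have h := hV1 s t hs1 hs2 ht1 ht2
    have hsq : (s - t) ^ 2 = ((z (i + 1) - z i) - (y (i + 1) - y i)) ^ 2 := by rw [htele]; ring
    rw [hc1]
    linarith
  · rw [hc2 k (by omega)]
    have hkpos : (0 : ℝ) < k := by exact_mod_cast (show 0 < k by omega)
    have h := hV2 (3 * k / 4) s t (by linarith) (by linarith) (by linarith)
    have hcs : (s - t) ^ 2 ≤
        k * ∑ l ∈ Finset.range k, ((z (i + l + 1) - z (i + l)) - (y (i + l + 1) - y (i + l))) ^ 2 := by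
      have := sq_sum_le_card_mul_sum_sq (s := Finset.range k)
        (f := fun l => (z (i + l + 1) - z (i + l)) - (y (i + l + 1) - y (i + l)))
      rw [Finset.card_range, htele] at this
      calc (s - t) ^ 2 = (t - s) ^ 2 := by ring
        _ ≤ _ := this
    calc V ((s + t) / 2) ≤ (V s + V t) / 2 + 7 / 8 * ((3 * (k : ℝ) / 4)⁻¹) ^ 8 * (s - t) ^ 2 := h
      _ ≤ (V s + V t) / 2 + 7 / 8 * ((3 * (k : ℝ) / 4)⁻¹) ^ 8 *
          (k * ∑ l ∈ Finset.range k,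
            ((z (i + l + 1) - z (i + l)) - (y (i + l + 1) - y (i + l))) ^ 2) := by
        gcongr
      _ = _ := by ring

/-- Summation of the slice weights `c` (`c 1 = −3/4`, `c k = (7/8)(3k/4)⁻⁸·k` for `k ≥ 2`):
`Σ_{k} Σ_{i} c(k) Σ_{l<k} g(i+l) ≤ −¼ Σ_{m<N-1} g m` for
nonnegative `g` (slice `k = 1` gives `−¾`, slices `k ≥ 2` at most `(57344/6561)/32 < ½`).
[folklore] -/
theorem lineConvex_correction_le (N : ℕ) (g : ℕ → ℝ) (hg : ∀ m, 0 ≤ g m)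
    (c : ℕ → ℝ) (hc1 : c 1 = -(3 / 4))
    (hc2 : ∀ k : ℕ, 2 ≤ k → c k = 7 / 8 * ((3 * (k : ℝ) / 4)⁻¹) ^ 8 * k) :
    ∑ k ∈ Finset.Ico 1 N, ∑ i ∈ Finset.range (N - k), c k * ∑ l ∈ Finset.range k, g (i + l) ≤
      -(1 / 4) * ∑ m ∈ Finset.range (N - 1), g m := by
  have hS0 : 0 ≤ ∑ m ∈ Finset.range (N - 1), g m := Finset.sum_nonneg fun m _ => hg m
  rcases lt_or_ge N 2 with hN | hN
  · have h1 : Finset.Ico 1 N = ∅ := Finset.Ico_eq_empty_of_le (by omega)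
    have h2 : N - 1 = 0 := by omega
    rw [h1, Finset.sum_empty, h2, Finset.sum_range_zero]
    norm_num
  rw [Finset.sum_eq_sum_Ico_succ_bot (by omega : 1 < N)]
  -- the slice `k = 1`
  have hk1 : ∑ i ∈ Finset.range (N - 1), c 1 * ∑ l ∈ Finset.range 1, g (i + l) =
      -(3 / 4) * ∑ m ∈ Finset.range (N - 1), g m := by
    rw [← Finset.mul_sum, hc1]
    simp only [Finset.sum_range_one, add_zero]
  -- the slices `k ≥ 2`
  have hterm : ∀ k ∈ Finset.Ico (1 + 1) N,
      ∑ i ∈ Finset.range (N - k), c k * ∑ l ∈ Finset.range k, g (i + l) ≤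
        57344 / 6561 * (∑ m ∈ Finset.range (N - 1), g m) * (1 / (k : ℝ) ^ 6) := by
    intro k hk
    rw [Finset.mem_Ico] at hk
    have hk0 : (k : ℝ) ≠ 0 := by exact_mod_cast (show k ≠ 0 by omega)
    have hT : ∑ i ∈ Finset.range (N - k), ∑ l ∈ Finset.range k, g (i + l) ≤
        k * ∑ m ∈ Finset.range (N - 1), g m := by
      rw [Finset.sum_comm]
      calc ∑ l ∈ Finset.range k, ∑ i ∈ Finset.range (N - k), g (i + l)
          ≤ ∑ l ∈ Finset.range k, ∑ m ∈ Finset.range (N - 1), g m :=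
            Finset.sum_le_sum fun l hl => lineConvex_shift_sum_le g hg (N - k) l (N - 1)
              (by rw [Finset.mem_range] at hl; omega)
        _ = k * ∑ m ∈ Finset.range (N - 1), g m := by
            rw [Finset.sum_const, Finset.card_range, nsmul_eq_mul]
    rw [← Finset.mul_sum, hc2 k (by omega)]
    calc 7 / 8 * ((3 * (k : ℝ) / 4)⁻¹) ^ 8 * k *
          ∑ i ∈ Finset.range (N - k), ∑ l ∈ Finset.range k, g (i + l)
        ≤ 7 / 8 * ((3 * (k : ℝ) / 4)⁻¹) ^ 8 * k * (k * ∑ m ∈ Finset.range (N - 1), g m) :=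
          mul_le_mul_of_nonneg_left hT (by positivity)
      _ = 57344 / 6561 * (∑ m ∈ Finset.range (N - 1), g m) * (1 / (k : ℝ) ^ 6) := by
          field_simp
          ring
  have hk2 : ∑ k ∈ Finset.Ico (1 + 1) N, ∑ i ∈ Finset.range (N - k),
      c k * ∑ l ∈ Finset.range k, g (i + l) ≤
        1 / 2 * ∑ m ∈ Finset.range (N - 1), g m :=
    calc _ ≤ ∑ k ∈ Finset.Ico (1 + 1) N,
          57344 / 6561 * (∑ m ∈ Finset.range (N - 1), g m) * (1 / (k : ℝ) ^ 6) :=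
            Finset.sum_le_sum hterm
      _ = 57344 / 6561 * (∑ m ∈ Finset.range (N - 1), g m) *
            ∑ k ∈ Finset.Ico 2 N, 1 / (k : ℝ) ^ 6 := by rw [← Finset.mul_sum]
      _ ≤ 57344 / 6561 * (∑ m ∈ Finset.range (N - 1), g m) * (1 / 32) :=
            mul_le_mul_of_nonneg_left (lineConvex_sum_inv_pow_six_le N)
              (mul_nonneg (by norm_num) hS0)
      _ ≤ 1 / 2 * ∑ m ∈ Finset.range (N - 1), g m := by linarith
  linarith

/-- **Registered stub `stub_lineEnergyConvex`** — UNIFORM MIDPOINT CONVEXITY OF THE LINE ENERGY IN GAP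
COORDINATES on the box `[3/4, 1]`: for any pair potential `V` which is uniformly midpoint-convex
(modulus `3/4`) on `[3/4, 1]` and at most `(7/8)R⁻⁸`-midpoint-concave on `[R, ∞)`, and two increasing
configurations `y, z` whose gaps lie in `[3/4, 1]`, the line energy of the midpoint configuration is
below the average by `¼ Σ_i ((z(i+1) − z i) − (y(i+1) − y i))²`. [folklore] -/
theorem stub_lineEnergyConvex : ∀ (V : ℝ → ℝ),
    (∀ s t : ℝ, 3 / 4 ≤ s → s ≤ 1 → 3 / 4 ≤ t → t ≤ 1 →
      V ((s + t) / 2) ≤ (V s + V t) / 2 - 3 / 4 * (s - t) ^ 2) →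
    (∀ R s t : ℝ, 0 < R → R ≤ s → R ≤ t →
      V ((s + t) / 2) ≤ (V s + V t) / 2 + 7 / 8 * (R⁻¹) ^ 8 * (s - t) ^ 2) →
    ∀ (N : ℕ) (y z : ℕ → ℝ),
      (∀ i : ℕ, i + 1 < N → 3 / 4 ≤ y (i + 1) - y i ∧ y (i + 1) - y i ≤ 1) →
      (∀ i : ℕ, i + 1 < N → 3 / 4 ≤ z (i + 1) - z i ∧ z (i + 1) - z i ≤ 1) →
      ∑ i ∈ Finset.range N, ∑ j ∈ Finset.Ico (i + 1) N, V ((y j + z j) / 2 - (y i + z i) / 2) ≤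
        (∑ i ∈ Finset.range N, ∑ j ∈ Finset.Ico (i + 1) N, V (y j - y i) +
          ∑ i ∈ Finset.range N, ∑ j ∈ Finset.Ico (i + 1) N, V (z j - z i)) / 2 -
        1 / 4 * ∑ i ∈ Finset.range (N - 1), ((z (i + 1) - z i) - (y (i + 1) - y i)) ^ 2 := by
  intro V hV1 hV2 N y z hy hz
  -- the slice weights: `−3/4` for nearest neighbours, `(7/8)(3k/4)⁻⁸·k` for `k ≥ 2`
  obtain ⟨c, hc1, hc2⟩ : ∃ c : ℕ → ℝ, c 1 = -(3 / 4) ∧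
      ∀ k : ℕ, 2 ≤ k → c k = 7 / 8 * ((3 * (k : ℝ) / 4)⁻¹) ^ 8 * k :=
    ⟨fun k => if k = 1 then -(3 / 4) else 7 / 8 * ((3 * (k : ℝ) / 4)⁻¹) ^ 8 * k, if_pos rfl,
      fun k hk => if_neg (by omega)⟩
  rw [lineConvex_sum_pair_reindex, lineConvex_sum_pair_reindex, lineConvex_sum_pair_reindex]
  have hsum : ∑ k ∈ Finset.Ico 1 N, ∑ i ∈ Finset.range (N - k),
      V ((y (i + k) + z (i + k)) / 2 - (y i + z i) / 2) ≤
        ∑ k ∈ Finset.Ico 1 N, ∑ i ∈ Finset.range (N - k),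
          ((V (y (i + k) - y i) + V (z (i + k) - z i)) / 2 + c k *
            ∑ l ∈ Finset.range k, ((z (i + l + 1) - z (i + l)) - (y (i + l + 1) - y (i + l))) ^ 2) :=
    Finset.sum_le_sum fun k hk => Finset.sum_le_sum fun i hi =>
      lineConvex_pointwise V hV1 hV2 hy hz c hc1 hc2 (Finset.mem_Ico.1 hk).1
        (by have := Finset.mem_Ico.1 hk; have := Finset.mem_range.1 hi; omega)
  have hcorr := lineConvex_correction_le N (fun m => ((z (m + 1) - z m) - (y (m + 1) - y m)) ^ 2)
    (fun m => sq_nonneg _) c hc1 hc2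
  simp only [Finset.sum_add_distrib, ← Finset.sum_div] at hsum
  linarith

end Summit.AtomisticToContinuum.Crystallization.Theorems.ThreeConeCertificateExactCertificate.Transfer1D
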